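import Literature.MathematicalPhysics.QuantumFieldTheory.Balaban1983to89.T3ContinuumYM3Torus
import Literature.MathematicalPhysics.QuantumFieldTheory.Balaban1983to89.B7Prop4Flat
import HarnessLib

/-!
# Line H (`BirthV10.stub_halvingStep`, stmt-QuantumFields-19200) — (M2′) (b)-row, σ-EDITION: (B-al-4)₅ — THE E-WINDOWS ARE INHABITED, AND THE TWO MAJORANT CONSTANTS ARE
# `O(L²ε₀)` ∕ `O(L·ε₀ + L·cσ)` (the scalar windows `hwin`, `hsmall` of ✓`HalvingEffGaugeLevelSeq.exists_levelSeq_rows_L` and the uniform sizes `hs ≤ 1∕64`, `ws ≤ 1∕600`,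
# at `d = 3`, every odd `L ≥ 3`, under ONE ε₀-window `10⁹·L³·ε₀ ≤ 1` and the σ-guard's budget `8·3800·((d+2)L)²·cσ ≤ 1` — for the LITERAL constants `hs`, `ws(cσ)` the knit
# instantiates from ROW (F-h) and the σ-edition of ROW (F-ω))

Cell `ym3-torus` (HUMAN RULING D-0037: YM₃ on T³ is ladder rung R3 — NOT d = 4, NOT infinite volume, NOT a mass gap, NOT the Clay problem), width seat
`ym-ust-20520-w3` gen 10 (LEAD-H ★w5-19200 g7 WORD 23∕24: «(B-al-4)₅ E-WINDOWS = w3-20520 g10; letter them for `cσ = O(s′)`»).  `--supports stmt-QuantumFields-19200 --as helper`;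
THEOREMS ONLY (0 `def`, 0 `sorry`); count-neutral; nothing here claims B-al, (F-h), (F-ω), (M2′), the stub, the crux or the gap.

WHY.  The (b)-row of the (M2′) assembly is closed down to arithmetic by ✓`HalvingEffGaugeRowG.hG_of_rows` ∘ ✓`HalvingDbarStairRowsOfGuards` ∘ `HalvingOmegaRowMember*` ∘
✓`HalvingEffGaugeLevelSeq`; what remains are windows on the two majorant constants
`hs = 4ℓ·(dd·(4ε₀) + (102∕100)·R)` (`ℓ = (d+2)L`, `dd = d(L−1)`, `R = 240·(C₂(d) + 40000(d+2)²)·δc²·ε₀²`, `δc = (2dL+1)(d(L−1)+L)`; ROW (F-h) through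
✓`stairSize_closedForm_le_mul_levelRatio`) and `ws = x⋆ + 2a⋆ + a⋆² + (2a⋆ + a⋆²)·x⋆` (`x⋆ = d(L−1)·(256(d+1)(d+4)·(2ε₀) + cσ)`, `a⋆ = 64d·cσ`; the σ-EDITION of
ROW (F-ω) through ✓`omega_closedForm_le_mul_levelRatio` at `cmax := cσ`), where `cσ` is the OUTER chart-budget letter of the σ-edition (LEAD-H WORD 24: tail guard `c′ ≤ cσ`,
`cσ := 2·(L·c⋆) = O(s′)` at the knit; `0 ≤ cσ`, `8·3800·((d+2)L)²·cσ ≤ 1`).  THIS FILE proves, at `d = 3`, every odd `L ≥ 3`, under `10⁹·L³·ε₀ ≤ 1`: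
`0 ≤ hs ≤ 3600·L²·ε₀ ≤ 1∕64`, `0 ≤ ws ≤ 43100·L·ε₀ + 133·L·cσ ≤ 1∕600`, `160·(3b) + 9900·ws + 16128·hs ≤ 1`, `3b ≤ 1∕200` (`b = 23040·hs·ws + 4800·ws²`) — so
✓`exists_levelSeq_rows_L` fires with `θG := 3b`, and the θ-BUDGET of the closure reads the two LINEAR sizes: `θG = O((L²ε₀ + L·cσ)²) = O(s′²)` (px20 g5's LOCATE-THETA-BUDGET 74908ee8 §3,
w8-19200 g10's window ledger (E)(9)).  The worst case of the uniform windows is the budget ceiling `cσ = (760000·L²)⁻¹` at `L = 3` (`9900·ws ≤ 0.63`).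
* §1 ★ `levelSeq_windows_real` — the eight facts over `ℝ` for letters `3 ≤ L`, `0 ≤ e`, `10⁹·L³·e ≤ 1`, `0 ≤ σ`, `8·3800·(5L)²·σ ≤ 1` and the constants written out
  (`C₂(3) + 40000·25 = 1160768`, `256·4·7 = 7168`, `64·3 = 192`);
* §2 `cast_*` ∕ `c1_eq` — the member's cast identities at `d = 3` (`↑((d+2)L) = 5L`, `↑(d(L−1)) = 3(L−1)`, `↑δc = (6L+1)(4L−3)`, `C2 d + 40000(↑d+2)² = 1160768`;
  `↑d = 3` and `3 ≤ ↑L` are ✓`Prop7ChartWindows.d_cast`∕`three_le_L`, re-derived inline here to keep the imports light);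
* §3 ★★★ `levelSeq_windows` — THE SAME IN THE KNIT's LITERAL LETTERS (`F : T3Family`, member `(n, K)`, outer `cσ`).
HONEST SCOPE.  Rational arithmetic only; no lattice object appears.

References: T. Bałaban, CMP **98** (1985) 17–51 [Balaban1985Averaging] (Prop. 4 p.38, (134)–(135) pp.38–39, (139)–(144) pp.39–40); CMP **99** (1985) 75–102
[Balaban1985RegularSpaces] ((1.29) p.81, (1.42) p.83).
-/

set_option autoImplicit false

namespace Summit.QuantumFields.YangMills.Theorems.HalvingEffGaugeLevelSeqWindows

open Literature.MathematicalPhysics.QuantumFieldTheory.Balaban1983to89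
open Literature.MathematicalPhysics.QuantumFieldTheory.Balaban1983to89.T3ContinuumYM3Torus

/-! ## §1 The windows over `ℝ` -/

set_option maxHeartbeats 400000 in
/-- ★ **THE E-WINDOWS OVER `ℝ` (σ-edition).**  `3 ≤ L`, `0 ≤ e`, `10⁹·L³·e ≤ 1`, `0 ≤ σ`, `8·3800·(5L)²·σ ≤ 1`, and the letters
`hs = 4·(5L)·(3(L−1)·(4e) + (102∕100)·(240·1160768·δc²·e²))`, `δc = (6L+1)(4L−3)`, `xs = 3(L−1)·(7168·(2e) + σ)`, `as = 192·σ`, `ws = xs + 2as + as² + (2as + as²)·xs` ⇒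
`0 ≤ hs ≤ 3600·L²e ≤ 1∕64`, `0 ≤ ws ≤ 43100·Le + 133·Lσ ≤ 1∕600`, `160·(3b) + 9900·ws + 16128·hs ≤ 1`, `3b ≤ 1∕200` (`b = 23040·hs·ws + 4800·ws²`).
[cite: Balaban1985Averaging, Prop. 4 p.38, (139)-(144) pp.39-40; Balaban1985RegularSpaces, (1.42) p.83] -/
theorem levelSeq_windows_real {L e σ hs δc xs as ws : ℝ} (hL : 3 ≤ L) (he0 : 0 ≤ e) (he : 10 ^ 9 * L ^ 3 * e ≤ 1)
    (hσ0 : 0 ≤ σ) (hσ1 : 8 * 3800 * (5 * L) ^ 2 * σ ≤ 1)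
    (hδc : δc = (6 * L + 1) * (4 * L - 3))
    (hhs : hs = 4 * (5 * L) * (3 * (L - 1) * (4 * e) + 102 / 100 * (240 * 1160768 * δc ^ 2 * e ^ 2)))
    (hxs : xs = 3 * (L - 1) * (7168 * (2 * e) + σ)) (has : as = 192 * σ)
    (hws : ws = xs + 2 * as + as ^ 2 + (2 * as + as ^ 2) * xs) :
    0 ≤ hs ∧ hs ≤ 3600 * (L ^ 2 * e) ∧ hs ≤ 1 / 64 ∧ 0 ≤ ws ∧ ws ≤ 43100 * (L * e) + 133 * (L * σ) ∧ ws ≤ 1 / 600 ∧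
      160 * (3 * (23040 * hs * ws + 4800 * ws ^ 2)) + 9900 * ws + 16128 * hs ≤ 1 ∧ 3 * (23040 * hs * ws + 4800 * ws ^ 2) ≤ 1 / 200 := by
  have hL0 : 0 < L := by linarith
  have hL1 : 0 ≤ L - 1 := by linarith
  -- the ε₀-window in the three powers of `L`
  have hL3e : L ^ 3 * e ≤ 1 / 10 ^ 9 := by
    rw [le_div_iff₀ (by norm_num : (0 : ℝ) < 10 ^ 9)]; linarith
  have hL2e0 : 0 ≤ L ^ 2 * e := by positivity
  have hL2e : L ^ 2 * e ≤ 1 / (3 * 10 ^ 9) := by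
    have h0 : 0 ≤ (L - 3) * (L ^ 2 * e) := mul_nonneg (sub_nonneg.2 hL) hL2e0
    have h : 3 * (L ^ 2 * e) ≤ L ^ 3 * e := by
      have e1 : (L - 3) * (L ^ 2 * e) = L ^ 3 * e - 3 * (L ^ 2 * e) := by ring
      linarith [e1 ▸ h0]
    rw [le_div_iff₀ (by norm_num : (0 : ℝ) < 3 * 10 ^ 9)]; linarith
  have hLe0 : 0 ≤ L * e := by positivity
  have hLe : L * e ≤ 1 / (9 * 10 ^ 9) := by
    have h9 : 9 ≤ L ^ 2 := by nlinarith
    have h0 : 0 ≤ (L ^ 2 - 9) * (L * e) := mul_nonneg (sub_nonneg.2 h9) hLe0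
    have h : 9 * (L * e) ≤ L ^ 3 * e := by
      have e1 : (L ^ 2 - 9) * (L * e) = L ^ 3 * e - 9 * (L * e) := by ring
      linarith [e1 ▸ h0]
    rw [le_div_iff₀ (by norm_num : (0 : ℝ) < 9 * 10 ^ 9)]; linarith
  -- the σ-budget: `σ ≤ 1∕(760000·L²)`
  have hσL2 : 760000 * (L ^ 2 * σ) ≤ 1 := by
    have e1 : 8 * 3800 * (5 * L) ^ 2 * σ = 760000 * (L ^ 2 * σ) := by ring
    linarith [e1 ▸ hσ1]
  have hLσ0 : 0 ≤ L * σ := by positivity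
  have h9σ : 9 * σ ≤ L ^ 2 * σ := by
    have h9 : 9 ≤ L ^ 2 := by nlinarith
    have h0 : 0 ≤ (L ^ 2 - 9) * σ := mul_nonneg (sub_nonneg.2 h9) hσ0
    have e1 : (L ^ 2 - 9) * σ = L ^ 2 * σ - 9 * σ := by ring
    linarith [e1 ▸ h0]
  have hσle : σ ≤ 1 / 6840000 := by
    rw [le_div_iff₀ (by norm_num : (0 : ℝ) < 6840000)]; linarith
  have h3σ : 3 * σ ≤ L * σ := by
    have h := mul_le_mul_of_nonneg_right hL hσ0
    linarith
  have hLσ : L * σ ≤ 1 / 2280000 := by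
    have h0 : 0 ≤ (L - 3) * (L * σ) := mul_nonneg (sub_nonneg.2 hL) hLσ0
    have e1 : (L - 3) * (L * σ) = L ^ 2 * σ - 3 * (L * σ) := by ring
    have h : 3 * (L * σ) ≤ L ^ 2 * σ := by linarith [e1 ▸ h0]
    rw [le_div_iff₀ (by norm_num : (0 : ℝ) < 2280000)]; linarith
  -- `δc ≤ 24L²`, and the quadratic term `R·L ≤ 160.5·L²e`
  have hδ0 : 0 ≤ δc := by rw [hδc]; exact mul_nonneg (by linarith) (by linarith)
  have hδle : δc ≤ 24 * L ^ 2 := by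
    have e1 : (6 * L + 1) * (4 * L - 3) = 24 * L ^ 2 - 14 * L - 3 := by ring
    rw [hδc, e1]; linarith
  have hδe0 : 0 ≤ δc * e := mul_nonneg hδ0 he0
  have hδe : δc * e ≤ 24 * (L ^ 2 * e) := by
    have h := mul_le_mul_of_nonneg_right hδle he0
    linarith
  have hδe2 : (δc * e) ^ 2 ≤ (24 * (L ^ 2 * e)) ^ 2 := pow_le_pow_left₀ hδe0 hδe 2
  have hRL : 240 * 1160768 * δc ^ 2 * e ^ 2 * L ≤ 240 * 1160768 * 576 * (1 / 10 ^ 9) * (L ^ 2 * e) := by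
    have h2 : (δc * e) ^ 2 * L ≤ (24 * (L ^ 2 * e)) ^ 2 * L := mul_le_mul_of_nonneg_right hδe2 hL0.le
    have h4 : (L ^ 3 * e) * (L ^ 2 * e) ≤ (1 / 10 ^ 9) * (L ^ 2 * e) := mul_le_mul_of_nonneg_right hL3e hL2e0
    calc 240 * 1160768 * δc ^ 2 * e ^ 2 * L = 240 * 1160768 * ((δc * e) ^ 2 * L) := by ring
      _ ≤ 240 * 1160768 * ((24 * (L ^ 2 * e)) ^ 2 * L) := mul_le_mul_of_nonneg_left h2 (by norm_num)
      _ = 240 * 1160768 * 576 * ((L ^ 3 * e) * (L ^ 2 * e)) := by ring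
      _ ≤ 240 * 1160768 * 576 * ((1 / 10 ^ 9) * (L ^ 2 * e)) := mul_le_mul_of_nonneg_left h4 (by norm_num)
      _ = 240 * 1160768 * 576 * (1 / 10 ^ 9) * (L ^ 2 * e) := by ring
  -- `hs ≤ 3600·L²e ≤ 12∕10⁷`
  have hhs0 : 0 ≤ hs := by rw [hhs]; positivity
  have hhslin : hs ≤ 3600 * (L ^ 2 * e) := by
    have h1 : hs = 240 * (L * (L - 1) * e) + 204 / 10 * (240 * 1160768 * δc ^ 2 * e ^ 2 * L) := by rw [hhs]; ring
    have h2 : L * (L - 1) * e ≤ L ^ 2 * e := by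
      have : L * (L - 1) * e = L ^ 2 * e - L * e := by ring
      linarith
    rw [h1]; linarith
  have hhsle : hs ≤ 12 / 10 ^ 7 := by linarith
  -- `xs ≤ 43008·Le + 3·Lσ`, `as ≤ 281∕10⁷`, `ws ≤ 43100·Le + 133·Lσ ≤ 1∕15000`
  have hxs0 : 0 ≤ xs := by rw [hxs]; positivity
  have hxslin : xs ≤ 43008 * (L * e) + 3 * (L * σ) := by
    have h1 : xs ≤ 3 * L * (7168 * (2 * e) + σ) := by
      rw [hxs]; exact mul_le_mul_of_nonneg_right (by linarith) (by positivity)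
    have h2 : 3 * L * (7168 * (2 * e) + σ) = 43008 * (L * e) + 3 * (L * σ) := by ring
    linarith
  have has0 : 0 ≤ as := by rw [has]; positivity
  have hasle : as ≤ 281 / 10 ^ 7 := by rw [has]; linarith
  have has64 : as ≤ 64 * (L * σ) := by rw [has]; linarith
  have hws0 : 0 ≤ ws := by rw [hws]; positivity
  have hwslin : ws ≤ 43100 * (L * e) + 133 * (L * σ) := by
    have h1 : as ^ 2 ≤ as * (281 / 10 ^ 7) := by
      rw [sq]; exact mul_le_mul_of_nonneg_left hasle has0
    have h2 : 2 * as + as ^ 2 ≤ 57 / 10 ^ 6 := by linarith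
    have h3 : (2 * as + as ^ 2) * xs ≤ 57 / 10 ^ 6 * xs := mul_le_mul_of_nonneg_right h2 hxs0
    rw [hws]; linarith
  have hwsle : ws ≤ 1 / 15000 := by linarith
  -- the windows
  have hHW : hs * ws ≤ 12 / 10 ^ 7 * (1 / 15000) := mul_le_mul hhsle hwsle hws0 (by norm_num)
  have hWW : ws ^ 2 ≤ (1 / 15000) ^ 2 := pow_le_pow_left₀ hws0 hwsle 2
  refine ⟨hhs0, hhslin, by linarith, hws0, hwslin, by linarith, ?_, ?_⟩
  · have e1 : 23040 * hs * ws = 23040 * (hs * ws) := by ring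
    rw [e1]; linarith
  · have e1 : 23040 * hs * ws = 23040 * (hs * ws) := by ring
    rw [e1]; linarith

/-! ## §2 The member's cast identities at `d = 3` -/

section Member

variable (F : T3Family) (K : ℕ)

/-- `↑((d+2)·L) = 5·L` at `d = 3`. [cite: Balaban1985UV3, p.256] -/
theorem cast_ell : ((((F.P K).d + 2) * (F.P K).L : ℕ) : ℝ) = 5 * ((F.P K).L : ℝ) := by
  push_cast; rw [(show (((F.P K).d : ℕ) : ℝ) = 3 by rw [T3Family.P_d]; norm_num)]; ring

/-- `↑(d·(L−1)) = 3·(L−1)` at `d = 3` (`1 ≤ L`, so the natural subtraction is exact). [cite: Balaban1985UV3, p.256] -/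
theorem cast_dd : (((F.P K).d * ((F.P K).L - 1) : ℕ) : ℝ) = 3 * (((F.P K).L : ℝ) - 1) := by
  have hL1 : 1 ≤ (F.P K).L := (F.P K).L_pos
  push_cast [Nat.cast_sub hL1]; rw [(show (((F.P K).d : ℕ) : ℝ) = 3 by rw [T3Family.P_d]; norm_num)]

/-- `↑δc = (6L+1)·(4L−3)` at `d = 3`, `δc = (2dL+1)(d(L−1)+L)`. [cite: Balaban1985Averaging, (127) p.37] -/
theorem cast_δc : ((((2 * ((F.P K).d * (F.P K).L) + 1) * ((F.P K).d * ((F.P K).L - 1) + (F.P K).L)) : ℕ) : ℝ) =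
    (6 * ((F.P K).L : ℝ) + 1) * (4 * ((F.P K).L : ℝ) - 3) := by
  have hL1 : 1 ≤ (F.P K).L := (F.P K).L_pos
  push_cast [Nat.cast_sub hL1]; rw [(show (((F.P K).d : ℕ) : ℝ) = 3 by rw [T3Family.P_d]; norm_num)]; ring

/-- `C₂(3) + 40000·(3+2)² = 8·1256·16 + 10⁶ = 1160768`. [cite: Balaban1985Averaging, (133) p.38, Prop. 4 p.39] -/
theorem c1_eq : B7Prop4Flat.C2 (F.P K).d + 40000 * ((((F.P K).d : ℕ) : ℝ) + 2) ^ 2 = 1160768 := by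
  unfold B7Prop4Flat.C2 B7Prop3Flat.C1; rw [(show (((F.P K).d : ℕ) : ℝ) = 3 by rw [T3Family.P_d]; norm_num)]; norm_num

end Member

/-! ## §3 The windows in the knit's literal letters -/

section Knit

variable (F : T3Family) (K : ℕ)

set_option maxHeartbeats 400000 in
/-- ★★★ **THE E-WINDOWS AT THE MEMBER, IN THE KNIT's LITERAL LETTERS (σ-edition).**  For every `T3Family` member, `0 ≤ ε₀` with `10⁹·L³·ε₀ ≤ 1`, and every chart budget
`0 ≤ cσ` with `8·3800·↑((d+2)L)²·cσ ≤ 1`, the two majorant constants `hs := 4·↑((d+2)L)·(↑(d(L−1))·(4ε₀) + (102∕100)·(240·(C₂ d + 40000(↑d+2)²)·↑δc²·ε₀²))`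
(ROW (F-h) through ✓`stairSize_closedForm_le_mul_levelRatio`) and `ws := x⋆ + 2a⋆ + a⋆² + (2a⋆ + a⋆²)·x⋆`, `x⋆ := ↑d·(↑L−1)·(256(↑d+1)(↑d+4)·(2ε₀) + cσ)`,
`a⋆ := 64·↑d·cσ` (ROW (F-ω)σ through ✓`omega_closedForm_le_mul_levelRatio` at `cmax := cσ`) satisfy `0 ≤ hs ≤ 3600·L²ε₀ ≤ 1∕64`, `0 ≤ ws ≤ 43100·Lε₀ + 133·L·cσ ≤ 1∕600` and
the two windows `hwin`, `hsmall` of ✓`exists_levelSeq_rows_L` — so the level sequence exists with `θG := 3·(23040·hs·ws + 4800·ws²)`, k-UNIFORMLY, and `θG = O((L²ε₀ + L·cσ)²)`.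
[cite: Balaban1985Averaging, Prop. 4 p.38, (134)-(135) pp.38-39, (139)-(144) pp.39-40; Balaban1985RegularSpaces, (1.29) p.81, (1.42) p.83] -/
theorem levelSeq_windows {ε₀ cσ : ℝ} (hε₀ : 0 ≤ ε₀) (hε : 10 ^ 9 * (F.L : ℝ) ^ 3 * ε₀ ≤ 1)
    (hσ0 : 0 ≤ cσ) (hσ1 : 8 * 3800 * ((((F.P K).d + 2) * (F.P K).L : ℕ) : ℝ) ^ 2 * cσ ≤ 1) :
    0 ≤ 4 * ((((F.P K).d + 2) * (F.P K).L : ℕ) : ℝ) * ((((F.P K).d * ((F.P K).L - 1) : ℕ) : ℝ) * (4 * ε₀) + 102 / 100 * (240 * (B7Prop4Flat.C2 (F.P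
      K).d + 40000 * (((F.P K).d : ℝ) + 2) ^ 2) * (((2 * ((F.P K).d * (F.P K).L) + 1) * ((F.P K).d * ((F.P K).L - 1) + (F.P K).L) : ℕ) : ℝ) ^ 2 * ε₀ ^
      2)) ∧
    4 * ((((F.P K).d + 2) * (F.P K).L : ℕ) : ℝ) * ((((F.P K).d * ((F.P K).L - 1) : ℕ) : ℝ) * (4 * ε₀) + 102 / 100 * (240 * (B7Prop4Flat.C2 (F.P K).d +
      40000 * (((F.P K).d : ℝ) + 2) ^ 2) * (((2 * ((F.P K).d * (F.P K).L) + 1) * ((F.P K).d * ((F.P K).L - 1) + (F.P K).L) : ℕ) : ℝ) ^ 2 * ε₀ ^ 2)) ≤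
      3600 * (((F.P K).L : ℝ) ^ 2 * ε₀) ∧
    4 * ((((F.P K).d + 2) * (F.P K).L : ℕ) : ℝ) * ((((F.P K).d * ((F.P K).L - 1) : ℕ) : ℝ) * (4 * ε₀) + 102 / 100 * (240 * (B7Prop4Flat.C2 (F.P K).d +
      40000 * (((F.P K).d : ℝ) + 2) ^ 2) * (((2 * ((F.P K).d * (F.P K).L) + 1) * ((F.P K).d * ((F.P K).L - 1) + (F.P K).L) : ℕ) : ℝ) ^ 2 * ε₀ ^ 2)) ≤
      1 / 64 ∧
    0 ≤ ((F.P K).d : ℝ) * (((F.P K).L : ℝ) - 1) * (256 * (((F.P K).d : ℝ) + 1) * (((F.P K).d : ℝ) + 4) * (2 * ε₀) + cσ) + 2 * (64 * ((F.P K).d : ℝ) *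
      cσ) + (64 * ((F.P K).d : ℝ) * cσ) ^ 2 + (2 * (64 * ((F.P K).d : ℝ) * cσ) + (64 * ((F.P K).d : ℝ) * cσ) ^ 2) * (((F.P K).d : ℝ) * (((F.P K).L :
      ℝ) - 1) * (256 * (((F.P K).d : ℝ) + 1) * (((F.P K).d : ℝ) + 4) * (2 * ε₀) + cσ)) ∧
    ((F.P K).d : ℝ) * (((F.P K).L : ℝ) - 1) * (256 * (((F.P K).d : ℝ) + 1) * (((F.P K).d : ℝ) + 4) * (2 * ε₀) + cσ) + 2 * (64 * ((F.P K).d : ℝ) * cσ)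
      + (64 * ((F.P K).d : ℝ) * cσ) ^ 2 + (2 * (64 * ((F.P K).d : ℝ) * cσ) + (64 * ((F.P K).d : ℝ) * cσ) ^ 2) * (((F.P K).d : ℝ) * (((F.P K).L : ℝ) -
      1) * (256 * (((F.P K).d : ℝ) + 1) * (((F.P K).d : ℝ) + 4) * (2 * ε₀) + cσ)) ≤ 43100 * (((F.P K).L : ℝ) * ε₀) + 133 * (((F.P K).L : ℝ) * cσ) ∧
    ((F.P K).d : ℝ) * (((F.P K).L : ℝ) - 1) * (256 * (((F.P K).d : ℝ) + 1) * (((F.P K).d : ℝ) + 4) * (2 * ε₀) + cσ) + 2 * (64 * ((F.P K).d : ℝ) * cσ)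
      + (64 * ((F.P K).d : ℝ) * cσ) ^ 2 + (2 * (64 * ((F.P K).d : ℝ) * cσ) + (64 * ((F.P K).d : ℝ) * cσ) ^ 2) * (((F.P K).d : ℝ) * (((F.P K).L : ℝ) -
      1) * (256 * (((F.P K).d : ℝ) + 1) * (((F.P K).d : ℝ) + 4) * (2 * ε₀) + cσ)) ≤ 1 / 600 ∧
    160 * (3 * (23040 * (4 * ((((F.P K).d + 2) * (F.P K).L : ℕ) : ℝ) * ((((F.P K).d * ((F.P K).L - 1) : ℕ) : ℝ) * (4 * ε₀) + 102 / 100 * (240 *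
      (B7Prop4Flat.C2 (F.P K).d + 40000 * (((F.P K).d : ℝ) + 2) ^ 2) * (((2 * ((F.P K).d * (F.P K).L) + 1) * ((F.P K).d * ((F.P K).L - 1) + (F.P K).L)
      : ℕ) : ℝ) ^ 2 * ε₀ ^ 2))) * (((F.P K).d : ℝ) * (((F.P K).L : ℝ) - 1) * (256 * (((F.P K).d : ℝ) + 1) * (((F.P K).d : ℝ) + 4) * (2 * ε₀) + cσ) + 2
      * (64 * ((F.P K).d : ℝ) * cσ) + (64 * ((F.P K).d : ℝ) * cσ) ^ 2 + (2 * (64 * ((F.P K).d : ℝ) * cσ) + (64 * ((F.P K).d : ℝ) * cσ) ^ 2) * (((F.P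
      K).d : ℝ) * (((F.P K).L : ℝ) - 1) * (256 * (((F.P K).d : ℝ) + 1) * (((F.P K).d : ℝ) + 4) * (2 * ε₀) + cσ))) + 4800 * (((F.P K).d : ℝ) * (((F.P
      K).L : ℝ) - 1) * (256 * (((F.P K).d : ℝ) + 1) * (((F.P K).d : ℝ) + 4) * (2 * ε₀) + cσ) + 2 * (64 * ((F.P K).d : ℝ) * cσ) + (64 * ((F.P K).d : ℝ)
      * cσ) ^ 2 + (2 * (64 * ((F.P K).d : ℝ) * cσ) + (64 * ((F.P K).d : ℝ) * cσ) ^ 2) * (((F.P K).d : ℝ) * (((F.P K).L : ℝ) - 1) * (256 * (((F.P K).d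
      : ℝ) + 1) * (((F.P K).d : ℝ) + 4) * (2 * ε₀) + cσ))) ^ 2)) + 9900 * (((F.P K).d : ℝ) * (((F.P K).L : ℝ) - 1) * (256 * (((F.P K).d : ℝ) + 1) *
      (((F.P K).d : ℝ) + 4) * (2 * ε₀) + cσ) + 2 * (64 * ((F.P K).d : ℝ) * cσ) + (64 * ((F.P K).d : ℝ) * cσ) ^ 2 + (2 * (64 * ((F.P K).d : ℝ) * cσ) +
      (64 * ((F.P K).d : ℝ) * cσ) ^ 2) * (((F.P K).d : ℝ) * (((F.P K).L : ℝ) - 1) * (256 * (((F.P K).d : ℝ) + 1) * (((F.P K).d : ℝ) + 4) * (2 * ε₀) +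
      cσ))) + 16128 * (4 * ((((F.P K).d + 2) * (F.P K).L : ℕ) : ℝ) * ((((F.P K).d * ((F.P K).L - 1) : ℕ) : ℝ) * (4 * ε₀) + 102 / 100 * (240 *
      (B7Prop4Flat.C2 (F.P K).d + 40000 * (((F.P K).d : ℝ) + 2) ^ 2) * (((2 * ((F.P K).d * (F.P K).L) + 1) * ((F.P K).d * ((F.P K).L - 1) + (F.P K).L)
      : ℕ) : ℝ) ^ 2 * ε₀ ^ 2))) ≤ 1 ∧
    3 * (23040 * (4 * ((((F.P K).d + 2) * (F.P K).L : ℕ) : ℝ) * ((((F.P K).d * ((F.P K).L - 1) : ℕ) : ℝ) * (4 * ε₀) + 102 / 100 * (240 *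
      (B7Prop4Flat.C2 (F.P K).d + 40000 * (((F.P K).d : ℝ) + 2) ^ 2) * (((2 * ((F.P K).d * (F.P K).L) + 1) * ((F.P K).d * ((F.P K).L - 1) + (F.P K).L)
      : ℕ) : ℝ) ^ 2 * ε₀ ^ 2))) * (((F.P K).d : ℝ) * (((F.P K).L : ℝ) - 1) * (256 * (((F.P K).d : ℝ) + 1) * (((F.P K).d : ℝ) + 4) * (2 * ε₀) + cσ) + 2
      * (64 * ((F.P K).d : ℝ) * cσ) + (64 * ((F.P K).d : ℝ) * cσ) ^ 2 + (2 * (64 * ((F.P K).d : ℝ) * cσ) + (64 * ((F.P K).d : ℝ) * cσ) ^ 2) * (((F.P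
      K).d : ℝ) * (((F.P K).L : ℝ) - 1) * (256 * (((F.P K).d : ℝ) + 1) * (((F.P K).d : ℝ) + 4) * (2 * ε₀) + cσ))) + 4800 * (((F.P K).d : ℝ) * (((F.P
      K).L : ℝ) - 1) * (256 * (((F.P K).d : ℝ) + 1) * (((F.P K).d : ℝ) + 4) * (2 * ε₀) + cσ) + 2 * (64 * ((F.P K).d : ℝ) * cσ) + (64 * ((F.P K).d : ℝ)
      * cσ) ^ 2 + (2 * (64 * ((F.P K).d : ℝ) * cσ) + (64 * ((F.P K).d : ℝ) * cσ) ^ 2) * (((F.P K).d : ℝ) * (((F.P K).L : ℝ) - 1) * (256 * (((F.P K).d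
      : ℝ) + 1) * (((F.P K).d : ℝ) + 4) * (2 * ε₀) + cσ))) ^ 2) ≤ 1 / 200 := by
  -- name the pieces and reduce to §1
  set L : ℝ := ((F.P K).L : ℝ) with hLdef
  have hFL : ((F.P K).L : ℝ) = (F.L : ℝ) := rfl
  have hL3 : 3 ≤ L := by
    have hodd : Odd (F.P K).L := F.hL.1
    have h3 : 3 ≤ (F.P K).L := by have := (F.P K).hL.2; obtain ⟨t, ht⟩ := hodd; omega
    rw [hLdef]; exact_mod_cast h3
  have hε' : 10 ^ 9 * L ^ 3 * ε₀ ≤ 1 := by rw [hLdef, hFL]; exact hε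
  have hσ1' : 8 * 3800 * (5 * L) ^ 2 * cσ ≤ 1 := by rw [hLdef, ← cast_ell]; exact hσ1
  have hd : (((F.P K).d : ℕ) : ℝ) = 3 := by rw [T3Family.P_d]; norm_num
  exact levelSeq_windows_real (δc := (6 * L + 1) * (4 * L - 3))
    (xs := ((F.P K).d : ℝ) * (((F.P K).L : ℝ) - 1) * (256 * (((F.P K).d : ℝ) + 1) * (((F.P K).d : ℝ) + 4) * (2 * ε₀) + cσ))
    (as := 64 * ((F.P K).d : ℝ) * cσ) hL3 hε₀ hε' hσ0 hσ1' rfl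
    (by rw [cast_ell, cast_dd, cast_δc, c1_eq])
    (by rw [hd]; ring)
    (by rw [hd]; ring)
    rfl

end Knit

end Summit.QuantumFields.YangMills.Theorems.HalvingEffGaugeLevelSeqWindows
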